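import Literature.NumberTheory.LFunctions.ZeroStatistics
import Literature.NumberTheory.LFunctions.ZetaArgVariation
import Literature.NumberTheory.LFunctions.ZetaFirstZeroCertificate
import HarnessLib

/-!
# Rudnick–Sarnak `n`-level correlations: local density of the normalised ordinates (proved)

Companion of `ZeroStatistics.lean` / `RHConditionalFacts.lean` (named fact
`Literature.NumberTheory.LFunctions.rudnick_sarnak`; Rudnick–Sarnak, *Duke Math. J.* **81**
(1996), Thm. 1.2 for `ζ`) and of `RudnickSarnakLocal.lean`. Proofs only: no definitions, no
named facts.

The `ζ`-specific input of the passage "limit along heights `T` ⟹ limit along all `N`" (see the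
module docstring of `RudnickSarnakLocal.lean`): zeros in short intervals and the local density
of Montgomery's normalised ordinates `γ̃_n = γ_n log γ_n / 2π` (`normalizedOrdinate`), all
derived from the tree's *proved* Riemann–von Mangoldt formula
(`riemann_von_mangoldt_holds`, `ZetaArgVariation.lean`) and `14 < γ₀`
(`fourteen_lt_zetaOrdinate_zero_holds`).

* `tendsto_zetaOrdinate_atTop`: `γ_n → ∞`.
* `RudnickSarnak.exists_zetaZeroCount_window_le`: there are `C > 0`, `T₁` with
  `N(u + 4) − N(u − 1) ≤ C log T` for `T ≥ T₁`, `0 ≤ u ≤ T` (Titchmarsh Thm. 9.2-type bound,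
  here a corollary of Thm. 9.4).
* `RudnickSarnak.card_filter_normalizedOrdinate_window_le`: each window `[y, y + 1]` contains
  at most `C log T` normalised ordinates `γ̃_c`, `c < N(T)` (the map `t ↦ t log t / 2π` expands
  distances by `≥ 1/π` on `t ≥ e²`, and `γ_c > 14 > e²`).
* `RudnickSarnak.zetaZeroCount_zetaOrdinate_sub_le`: `N(γ_N) − N ≤ C log γ_N` (the jump of `N`
  at a height, i.e. the multiplicity cluster, is `≪ log T`).

## References

* Z. Rudnick, P. Sarnak, *Zeros of principal `L`-functions and random matrix theory*, Duke
  Math. J. 81 (1996), 269–322, §§1, 3.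
* E. C. Titchmarsh, *The Theory of the Riemann Zeta-Function*, 2nd ed. (1986), Thms. 9.2, 9.4.
-/

noncomputable section

open Filter Topology Finset

namespace Literature.NumberTheory.LFunctions

/-- The ordinates tend to infinity, `γ_n → ∞`: if `γ_n ≤ T` then `n + 1 ≤ N(T)`
(`riemann_von_mangoldt.zetaOrdinate_le_iff`), and `N(T)` is finite.
[cite: Titchmarsh1986, §9.1] -/
theorem tendsto_zetaOrdinate_atTop : Tendsto zetaOrdinate atTop atTop := by
  refine tendsto_atTop_atTop.2 fun T ↦ ⟨zetaZeroCount T, fun n hn ↦ ?_⟩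
  by_contra h
  have h' : zetaOrdinate n ≤ T := (not_le.1 h).le
  have := riemann_von_mangoldt_holds.zetaOrdinate_le_iff.1 h'
  omega

namespace RudnickSarnak

/-! ## Zeros in short intervals from the Riemann–von Mangoldt formula -/

/-- Increment of the Riemann–von Mangoldt main term `m(t) = (t/2π) log(t/2π) − t/2π`:
`m(b) − m(a) ≤ ((b − a)/2π) log(b/2π)` for `0 < a ≤ b` (from `log x ≤ x − 1`).
[cite: Titchmarsh1986, Thm. 9.4] -/
theorem rvmMain_sub_le {a b : ℝ} (ha : 0 < a) (hab : a ≤ b) :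
    (b / (2 * Real.pi) * Real.log (b / (2 * Real.pi)) - b / (2 * Real.pi)) -
        (a / (2 * Real.pi) * Real.log (a / (2 * Real.pi)) - a / (2 * Real.pi)) ≤
      (b - a) / (2 * Real.pi) * Real.log (b / (2 * Real.pi)) := by
  have hb : 0 < b := ha.trans_le hab
  have hpi : 0 < 2 * Real.pi := by positivity
  have hlog : Real.log (b / (2 * Real.pi)) - Real.log (a / (2 * Real.pi)) = Real.log (b / a) := by
    rw [← Real.log_div (by positivity) (by positivity)]
    congr 1
    field_simp
  have hkey : a * (Real.log (b / (2 * Real.pi)) - Real.log (a / (2 * Real.pi))) ≤ b - a := by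
    rw [hlog]
    have h := Real.log_le_sub_one_of_pos (show 0 < b / a by positivity)
    calc a * Real.log (b / a) ≤ a * (b / a - 1) := mul_le_mul_of_nonneg_left h ha.le
      _ = b - a := by field_simp
  rw [show (b / (2 * Real.pi) * Real.log (b / (2 * Real.pi)) - b / (2 * Real.pi)) -
        (a / (2 * Real.pi) * Real.log (a / (2 * Real.pi)) - a / (2 * Real.pi)) =
      ((b - a) * Real.log (b / (2 * Real.pi)) +
        a * (Real.log (b / (2 * Real.pi)) - Real.log (a / (2 * Real.pi))) - (b - a)) /
          (2 * Real.pi) by ring,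
    show (b - a) / (2 * Real.pi) * Real.log (b / (2 * Real.pi)) =
      ((b - a) * Real.log (b / (2 * Real.pi))) / (2 * Real.pi) by ring]
  exact div_le_div_of_nonneg_right (by linarith) hpi.le

/-- `1 ≤ log T` for `T ≥ 4` (`e < 2.72 < 4`). [folklore] -/
theorem one_le_log_of_four_le {T : ℝ} (hT : 4 ≤ T) : 1 ≤ Real.log T := by
  rw [Real.le_log_iff_exp_le (by linarith)]
  have := Real.exp_one_lt_d9
  linarith

/-- **Zeros in short intervals** (corollary of the Riemann–von Mangoldt formula, Titchmarsh
Thm. 9.4; cf. Thm. 9.2 `N(T + 1) − N(T) = O(log T)`): there are `C > 0` and `T₁` such that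
`N(u + 4) − N(u − 1) ≤ C log T` whenever `T ≥ T₁` and `0 ≤ u ≤ T`. For `u − 1` below the
threshold of the `O(log T)` bound the left side is bounded by a constant; above it, the main term
increases by `≤ (5/2π) log((u+4)/2π) ≤ log(u + 4)` and the two error terms are `≤ C₀ log(u+4)`
each, and `log(u + 4) ≤ log(2T) ≤ 2 log T`. [cite: Titchmarsh1986, Thm. 9.2] -/
theorem exists_zetaZeroCount_window_le :
    ∃ C : ℝ, 0 < C ∧ ∃ T₁ : ℝ, ∀ T : ℝ, T₁ ≤ T → ∀ u : ℝ, 0 ≤ u → u ≤ T →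
      (zetaZeroCount (u + 4) : ℝ) - zetaZeroCount (u - 1) ≤ C * Real.log T := by
  obtain ⟨C₀, hC₀, hbd⟩ := riemann_von_mangoldt_holds.exists_pos
  obtain ⟨t₀, ht₀⟩ := eventually_atTop.1 (hbd.bound.and (eventually_ge_atTop (1 : ℝ)))
  set B : ℝ := ((zetaZeroCount (t₀ + 5) : ℕ) : ℝ) with hB
  have hB0 : 0 ≤ B := Nat.cast_nonneg _
  refine ⟨2 * (1 + 2 * C₀) + B, by positivity, 4, fun T hT u hu0 huT ↦ ?_⟩
  have hlogT : 1 ≤ Real.log T := one_le_log_of_four_le hT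
  rcases lt_or_ge (u - 1) t₀ with hu | hu
  · -- small heights: bounded by the constant `B = N(t₀ + 5)`
    have h1 : (zetaZeroCount (u + 4) : ℝ) ≤ B := by
      rw [hB]
      exact_mod_cast zetaZeroCount_mono (by linarith : u + 4 ≤ t₀ + 5)
    have h2 : (0 : ℝ) ≤ zetaZeroCount (u - 1) := Nat.cast_nonneg _
    have h3 : B ≤ B * Real.log T := le_mul_of_one_le_right hB0 hlogT
    have h4 : 0 ≤ 2 * (1 + 2 * C₀) * Real.log T := by positivity
    nlinarith
  · -- large heights: Riemann–von Mangoldt at `u - 1` and `u + 4`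
    obtain ⟨hb1, h1le⟩ := ht₀ (u - 1) hu
    obtain ⟨hb2, -⟩ := ht₀ (u + 4) (by linarith)
    have hl1 : 0 ≤ Real.log (u - 1) := Real.log_nonneg h1le
    have hl2 : 0 ≤ Real.log (u + 4) := Real.log_nonneg (by linarith)
    rw [Real.norm_of_nonneg hl1, Real.norm_eq_abs] at hb1
    rw [Real.norm_of_nonneg hl2, Real.norm_eq_abs] at hb2
    have hb1' := (abs_le.1 hb1).1
    have hb2' := (abs_le.1 hb2).2
    -- main term increment
    have hmain := rvmMain_sub_le (a := u - 1) (b := u + 4) (by linarith) (by linarith)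
    have hincr : (u + 4 - (u - 1)) / (2 * Real.pi) * Real.log ((u + 4) / (2 * Real.pi)) ≤
        Real.log (u + 4) := by
      have hcoef : (u + 4 - (u - 1)) / (2 * Real.pi) ≤ 1 := by
        rw [div_le_one (by positivity)]
        linarith [Real.pi_gt_three]
      have hcoef0 : 0 ≤ (u + 4 - (u - 1)) / (2 * Real.pi) :=
        div_nonneg (by linarith) (by positivity)
      have hle : Real.log ((u + 4) / (2 * Real.pi)) ≤ Real.log (u + 4) :=
        Real.log_le_log (by positivity) (div_le_self (by linarith) (by linarith [Real.pi_gt_three]))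
      rcases le_or_gt 0 (Real.log ((u + 4) / (2 * Real.pi))) with h0 | h0
      · calc (u + 4 - (u - 1)) / (2 * Real.pi) * Real.log ((u + 4) / (2 * Real.pi))
            ≤ 1 * Real.log ((u + 4) / (2 * Real.pi)) := mul_le_mul_of_nonneg_right hcoef h0
          _ ≤ Real.log (u + 4) := by rw [one_mul]; exact hle
      · have : (u + 4 - (u - 1)) / (2 * Real.pi) * Real.log ((u + 4) / (2 * Real.pi)) ≤ 0 :=
          mul_nonpos_of_nonneg_of_nonpos hcoef0 h0.le
        linarith
    -- `log (u - 1) ≤ log (u + 4) ≤ log (2T) ≤ 2 log T`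
    have hl12 : Real.log (u - 1) ≤ Real.log (u + 4) := Real.log_le_log (by linarith) (by linarith)
    have hl2T : Real.log (u + 4) ≤ 2 * Real.log T := by
      have h2 : Real.log 2 ≤ Real.log T := Real.log_le_log (by norm_num) (by linarith)
      calc Real.log (u + 4) ≤ Real.log (2 * T) := Real.log_le_log (by linarith) (by linarith)
        _ = Real.log 2 + Real.log T := Real.log_mul (by norm_num) (by linarith)
        _ ≤ 2 * Real.log T := by linarith
    have hBlog : 0 ≤ B * Real.log T := by positivity
    nlinarith [mul_le_mul_of_nonneg_left hl2T hC₀.le, mul_le_mul_of_nonneg_left hl12 hC₀.le]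

/-! ## Local density of the normalised ordinates -/

/-- The normalisation `t ↦ t log t / 2π` expands distances by at least `1/π` on `log t ≥ 2`:
for `0 < a ≤ b` with `2 ≤ log a`, `(b − a)/π ≤ b log b / 2π − a log a / 2π`. [folklore] -/
theorem sub_div_pi_le_of_two_le_log {a b : ℝ} (ha : 0 < a) (hab : a ≤ b) (hla : 2 ≤ Real.log a) :
    (b - a) / Real.pi ≤
      b * Real.log b / (2 * Real.pi) - a * Real.log a / (2 * Real.pi) := by
  have hlab : Real.log a ≤ Real.log b := Real.log_le_log ha hab
  have hb : 0 ≤ b := ha.le.trans hab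
  have hkey : 2 * (b - a) ≤ b * Real.log b - a * Real.log a := by
    nlinarith [mul_le_mul_of_nonneg_left hlab hb]
  rw [show b * Real.log b / (2 * Real.pi) - a * Real.log a / (2 * Real.pi) =
      (b * Real.log b - a * Real.log a) / (2 * Real.pi) by ring,
    div_le_div_iff₀ Real.pi_pos (by positivity)]
  nlinarith [Real.pi_pos]

/-- `2 ≤ log γ_n` for every `n`: `γ_n ≥ γ₀ > 14 > e²`. [cite: Gram1903] -/
theorem two_le_log_zetaOrdinate (n : ℕ) : 2 ≤ Real.log (zetaOrdinate n) := by
  have h14 : 14 < zetaOrdinate n :=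
    fourteen_lt_zetaOrdinate_zero_holds.trans_le (zetaOrdinate_mono_holds (Nat.zero_le n))
  rw [Real.le_log_iff_exp_le (by linarith)]
  have h1 := Real.exp_one_lt_d9
  have h2 : Real.exp 2 = Real.exp 1 * Real.exp 1 := by rw [← Real.exp_add]; norm_num
  nlinarith [Real.exp_pos 1]

/-- **Local density of `γ̃`.** If `N(u + 4) − N(u − 1) ≤ C log T` for all `0 ≤ u ≤ T` (as in
`exists_zetaZeroCount_window_le`), then every window `[y, y + 1]` contains at most `C log T`
normalised ordinates `γ̃_c` with `c < N(T)` (`T ≥ 0`): the indices in the window lie between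
its least element `c₁` and its largest `c₂`, `γ̃_{c₂} − γ̃_{c₁} ≤ 1` forces
`γ_{c₂} ≤ γ_{c₁} + π ≤ γ_{c₁} + 4` (`sub_div_pi_le_of_two_le_log`), and
`N(γ_{c₁} − 1) ≤ c₁ ≤ c₂ < N(γ_{c₂}) ≤ N(γ_{c₁} + 4)`. [cite: RudnickSarnak1996, §1] -/
theorem card_filter_normalizedOrdinate_window_le {T C : ℝ} (hT : 0 ≤ T)
    (hwin : ∀ u : ℝ, 0 ≤ u → u ≤ T →
      (zetaZeroCount (u + 4) : ℝ) - zetaZeroCount (u - 1) ≤ C * Real.log T)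
    (y : ℝ) :
    (((Finset.range (zetaZeroCount T)).filter fun c ↦
        y ≤ normalizedOrdinate c ∧ normalizedOrdinate c ≤ y + 1).card : ℝ) ≤ C * Real.log T := by
  classical
  set W := (Finset.range (zetaZeroCount T)).filter fun c ↦
    y ≤ normalizedOrdinate c ∧ normalizedOrdinate c ≤ y + 1 with hW
  rcases W.eq_empty_or_nonempty with hW0 | hWne
  · have h0 := hwin 0 le_rfl hT
    have h4 : (0 : ℝ) ≤ zetaZeroCount (0 + 4) := Nat.cast_nonneg _
    rw [zetaZeroCount_eq_zero_of_nonpos (by norm_num : (0 : ℝ) - 1 ≤ 0)] at h0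
    simp only [hW0, Finset.card_empty, Nat.cast_zero]
    push_cast at h0
    linarith
  · set c₁ := W.min' hWne with hc₁
    set c₂ := W.max' hWne with hc₂
    have hc₁W : c₁ ∈ W := Finset.min'_mem W hWne
    have hc₂W : c₂ ∈ W := Finset.max'_mem W hWne
    have hc₁₂ : c₁ ≤ c₂ := Finset.min'_le W c₂ hc₂W
    rw [hW, Finset.mem_filter, Finset.mem_range] at hc₁W hc₂W
    have hRvM := riemann_von_mangoldt_holds
    -- ordinates
    have hγpos : 0 < zetaOrdinate c₁ := zetaOrdinate_pos_holds c₁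
    have hγ₁₂ : zetaOrdinate c₁ ≤ zetaOrdinate c₂ := zetaOrdinate_mono_holds hc₁₂
    have hγ₁T : zetaOrdinate c₁ ≤ T := hRvM.zetaOrdinate_le_iff.2 (by omega)
    -- `γ_{c₂} ≤ γ_{c₁} + 4`
    have hexp := sub_div_pi_le_of_two_le_log hγpos hγ₁₂ (two_le_log_zetaOrdinate c₁)
    have hdiff : zetaOrdinate c₂ * Real.log (zetaOrdinate c₂) / (2 * Real.pi) -
        zetaOrdinate c₁ * Real.log (zetaOrdinate c₁) / (2 * Real.pi) ≤ 1 := by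
      have h1 := hc₁W.2.1
      have h2 := hc₂W.2.2
      simp only [normalizedOrdinate] at h1 h2
      linarith
    have hγ₂ : zetaOrdinate c₂ ≤ zetaOrdinate c₁ + 4 := by
      have h := hexp.trans hdiff
      rw [div_le_one Real.pi_pos] at h
      linarith [Real.pi_le_four]
    -- counting
    have hup : c₂ + 1 ≤ zetaZeroCount (zetaOrdinate c₁ + 4) :=
      (hRvM.succ_le_zetaZeroCount c₂).trans (zetaZeroCount_mono hγ₂)
    have hlow : zetaZeroCount (zetaOrdinate c₁ - 1) ≤ c₁ :=
      hRvM.zetaZeroCount_le_of_lt_zetaOrdinate (by linarith)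
    have hcard : W.card ≤ c₂ + 1 - c₁ := by
      calc W.card ≤ (Finset.Icc c₁ c₂).card :=
            Finset.card_le_card fun c hc ↦
              Finset.mem_Icc.2 ⟨Finset.min'_le W c hc, Finset.le_max' W c hc⟩
        _ = c₂ + 1 - c₁ := Nat.card_Icc c₁ c₂
    have hnat : W.card + zetaZeroCount (zetaOrdinate c₁ - 1) ≤
        zetaZeroCount (zetaOrdinate c₁ + 4) := by omega
    have hreal : (W.card : ℝ) ≤ (zetaZeroCount (zetaOrdinate c₁ + 4) : ℝ) -
        zetaZeroCount (zetaOrdinate c₁ - 1) := by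
      have := (Nat.cast_le (α := ℝ)).2 hnat
      push_cast at this
      linarith
    exact hreal.trans (hwin _ hγpos.le hγ₁T)

/-- The jump of `N` at the height `γ_N` is small: `N(γ_N) − N ≤ C log γ_N` once `γ_N ≥ T₁`
(with `C`, `T₁` as in `exists_zetaZeroCount_window_le`), since
`N(γ_N − 1) ≤ N < N + 1 ≤ N(γ_N) ≤ N(γ_N + 4)`. [cite: Titchmarsh1986, Thm. 9.2] -/
theorem zetaZeroCount_zetaOrdinate_sub_le {C : ℝ} {N : ℕ}
    (hwin : ∀ u : ℝ, 0 ≤ u → u ≤ zetaOrdinate N →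
      (zetaZeroCount (u + 4) : ℝ) - zetaZeroCount (u - 1) ≤ C * Real.log (zetaOrdinate N)) :
    (zetaZeroCount (zetaOrdinate N) : ℝ) - N ≤ C * Real.log (zetaOrdinate N) := by
  have hRvM := riemann_von_mangoldt_holds
  have h1 : zetaZeroCount (zetaOrdinate N - 1) ≤ N :=
    hRvM.zetaZeroCount_le_of_lt_zetaOrdinate (by linarith)
  have h2 : zetaZeroCount (zetaOrdinate N) ≤ zetaZeroCount (zetaOrdinate N + 4) :=
    zetaZeroCount_mono (by linarith)
  have h3 := hwin (zetaOrdinate N) (zetaOrdinate_pos_holds N).le le_rfl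
  have h1' : (zetaZeroCount (zetaOrdinate N - 1) : ℝ) ≤ N := by exact_mod_cast h1
  have h2' : (zetaZeroCount (zetaOrdinate N) : ℝ) ≤ zetaZeroCount (zetaOrdinate N + 4) := by
    exact_mod_cast h2
  linarith

/-- `N < N(γ_N)` (the infimum defining `γ_N` is attained; `riemann_von_mangoldt.succ_le_zetaZeroCount`).
[cite: Titchmarsh1986, §9.1] -/
theorem lt_zetaZeroCount_zetaOrdinate (N : ℕ) : N < zetaZeroCount (zetaOrdinate N) :=
  riemann_von_mangoldt_holds.succ_le_zetaZeroCount N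

end RudnickSarnak

end Literature.NumberTheory.LFunctions

end
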